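import Literature.IUT.LogVolume.DegreeVolumeConversion
import Mathlib.Order.Closure
import HarnessLib

/-!
# The indeterminacies (Ind1), (Ind2), (Ind3) acting on regions of `𝕃`, the region `U_Θ`, and hulls —
# at the level of Dupuy–Hilado, *The statement of Mochizuki's Corollary 3.12*, §4 (intro, §4.7,
# §4.9–§4.12)

Dupuy–Hilado, arXiv:2004.13228 (PRE-SPLIT text: v2 of 19 Jun 2025 announces that the Ind1/Ind2 material
moved out; the held corpus render `paper:arxiv-2004.13228` still contains §4, chunks 13–16; Ramanujan J.
**68** (2025)), read on the page:

* §4 intro: "At the level of `𝕃_p^{(j)} := 𝔸^{⊗ j+1}_{V̲,p}` elements of Ind1 are just automorphisms of the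
  finite dimensional `ℚ_p`-vector spaces `𝕃_p^{(j)}` induced by automorphisms of the `ℤ_p`-lattice
  `I^{⊗ j+1}_{V̲,p} ⊂ 𝕃_p^{(j)}` defined by `I^{⊗ j+1}_{V̲,p} := ⊕_{v⃗ ∈ V(F₀)_p^{j+1}} I_{v⃗}`, where if
  `v⃗ = (v̲_0,…,v̲_j)`, then `I_{v⃗} = I_{v̲_0} ⊗ ⋯ ⊗ I_{v̲_j}` and for `v̲ ∈ V̲` we define
  `I_{v̲} = (1/2p_{v̲}) log(O^×_{v̲})`. The `I_{v̲}` are Mochizuki's so-called log-shells. We will also see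
  that the Ind2 indeterminacies also preserve this lattice."
* §4.7 (Formula for Ind1): "if `f_j = f_j(γ) : {0,…,j} → {0,…,j}` is the underlying permutation of the
  `j`th capsule in the automorphism then on the summand `K_{v̲_0} ⊗ ⋯ ⊗ K_{v̲_j}` we have
  `K_{v̲_0} ⊗ ⋯ ⊗ K_{v̲_j} → K_{v̲_{f_j^{−1}(0)}} ⊗ ⋯ ⊗ K_{v̲_{f_j^{−1}(j)}} ⊂ 𝔸^{⊗ j+1}_{V̲,p}` which acts on
  simple tensors as `x_0 ⊗ ⋯ ⊗ x_j ↦ x_{f_j^{−1}(j)} ⊗ ⋯ ⊗ x_{f_j^{−1}(0)}`. This map is `ℚ_p`-linear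
  and fixes the lattice `⊕ I_{(v̲_0,…,v̲_j)} ⊂ 𝕃_{p,j}`. … We will call Ind1 the collection of all such
  permutations acting on `𝔸^{⊗ j+1}_{V̲,p}` … for all `p`, the action of Ind1 on `𝔸^{⊗ j+1}_{V̲,p}` is
  simultaneous, that is `σ ∈ S_{j+1}` acts on `Π_p Aut_{V̲}` with the action as prescribed on each factor."
* §4.9 (`p`-adic Ind2): "These indeterminacies are referred to as "isometries" in [IUT2]. [footnote:
  Invertible linear maps on finite dimensional `ℚ_p`-vector spaces have determinant one. This means the
  distortion factor (the determinant) is 1 and the measure of sets are preserved under these maps.] They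
  act through the group `Aut_{ℚ_p}(K_{v⃗} : I_{v⃗}) = {φ ∈ Vect_{ℚ_p}(K_{v⃗}, K_{v⃗}) : φ(I_{v⃗}) ⊂ I_{v⃗}}`.
  Another way to see these are as `ℚ_p`-vector space automorphisms which arise as `ℤ_p`-lattice
  isomorphisms of `I_{v̲}`. Abusively, we will let Ind2 denote the collection of automorphisms induced
  by these automorphisms on `𝕃_p^{(j)}`, `𝕃_p`, and `𝕃` (which are given as products of the automorphisms
  on each of the summands)."
* §4.10 (`p`-adic Ind3): "This is a map `Ind3 : 2^𝕃 → 2^𝕃` where `2^𝕃` denotes the power set. … we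
  assume a bound on `O_𝕃(−P_Θ)^{Ind3}` which is given locally on the `p`-part in `Peel^j_{v̲}` component
  by `(q̲_{v̲}^{j²/2l})^ℕ · Peel^j_{v̲} I^{⊗ j+1}_{V̲}` (4.10)"; §1 p. 4: "the meaning of the symbol
  `(O_𝕃(−P_Θ))^{Ind3}` is a bit nuanced and is not just the application of the function `Ind3` on a
  set".
* §4.11: "The multiradial representation of the theta pilot region is the region
  `U_Θ := Ind2(Ind1((O_𝕃(−P_Θ))^{Ind3})) ⊂ 𝕃`." (§1 p. 3: "The order of operations … is intentional and
  correct.")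
* §4.12: "As `𝕃 = Π_p 𝕃_p` … it suffices to define hulls locally … `hull(Ω) := Π_p hull(Ω_p)`. … Let
  `L = L_1 ⊕ ⋯ ⊕ L_s` be a product of local fields. The hull of `Ω ⊂ L` is then defined to be the
  smallest polydisc containing `Ω`"; Rmk. 4.12.1: "regions like the local factors of `U_Θ` do not have
  module structures. The hull construction repairs this by taking the smallest possible module
  containing this regions."

WHAT THIS FILE DOES (top-down, statements-first; over `DegreeVolumeConversion.PacketModel`).
`IndPacketModel` extends the packet interface by exactly the data §4 uses: the log-shell lattices
`I_{v⃗}` (D6 of the cell's L-DH list; their construction from the `p`-adic logarithm is campaign work),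
the (Ind1) TRANSPORT along a permutation of tensor factors between the summands indexed by `v⃗ ∘ σ` and
`v⃗` (§4.7), the (Ind2) groups acting on each summand (§4.9), and a hull closure operator on each summand
(§4.12) — with, as fields, the printed properties: Ind1 "fixes the lattice" and maps integral structure
to integral structure, Ind2 "preserve this lattice" and "the measure of sets are preserved". ONE
MODELLING FIELD is not a quotation and is flagged as such: `logμ_perm` (the factor permutation
`K_{v⃗∘σ} ≅ K_{v⃗}` preserves normalised log-measures) — it is a ring isomorphism carrying `O_{v⃗∘σ}` to
`O_{v⃗}`, so it carries the Haar measure normalised by `μ(O) = 1` (§2.4.5) to the one so normalised; the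
concrete model must discharge it. (Ind3) is typed, following §4.10 and §1 p. 4, NOT as a function on sets
but as a DATUM attached to a theta-idele: a region `(O_𝕃(−P_Θ))^{Ind3}` containing `O_𝕃(−P_Θ)` (the
upper-bound formulation; [IUTchIII] Thm. 3.11 (ii) (Ind3) "natural inclusions "⊆""; the same design as
the containment field of the cell's staged skeleton file `ForkInflation` (XVIII), not yet in the tree) and
bounded by (4.10). Over this: the regions `σ·B`, `g·B`,
`U_Θ` as the family `{g·σ·(O_𝕃(−P_Θ))^{Ind3}}` and its union, the hull; and the THEOREMS that (Ind1) and
(Ind2) PRESERVE `ln ν̄_𝕃` (`lnνL_ind1`, `lnνL_ind2` — the first by the permutation invariance of the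
product weights, `FiniteProbability.ProbWeights.pi_pr_comp_perm`), that every possible image has the
log-volume of `(O_𝕃(−P_Θ))^{Ind3}` (`lnνL_UTheta`), and hull monotonicity (`lnνL_le_hull`). HONEST SCOPE of
these invariance theorems: their Lean content is the re-indexing of the weighted sums over tuples
(`Equiv.prod_comp`, `Function.Bijective.sum_comp`); the summand-level invariance is NOT proved here but
REDUCED to the interface fields `logμ_perm` (modelling: the ring isomorphism carrying `O_{v⃗∘σ}` to `O_{v⃗}`
with `μ(O) = 1`) and `logμ_smul` (Dupuy–Hilado §4.9 footnote), which a concrete tensor-packet model must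
prove.

Deliberately NOT here: the inequality (1.1) itself and its readings (hypotheses of the disputed step;
the cell keeps them under `Summits/ABC/IUTFork/`), the derivation of Ind3 ([Dupuy2020c]), archimedean
factors, processions/capsules as categories (§4.3–4.6, 4.8), Frobenioids/prime-strips (§4.5).
-/

noncomputable section

namespace Literature.IUT.LogVolume

open NumberField IsDedekindDomain Finset
open scoped Pointwise

variable (F : Type*) [Field F] [NumberField F]

/-! ## The interface: log-shells, (Ind1) transports, (Ind2) groups, local hulls -/

/-- **Packet model with indeterminacies** (INTERFACE for Dupuy–Hilado §4 intro, §4.7, §4.9, §4.12 over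
`PacketModel`): the log-shell lattices `I_{v⃗} ⊂ X_{v⃗}`; for every permutation `σ` of the tensor indices
`{0,…,j}` the (Ind1) transport `X_{v⃗∘σ} ≃ X_{v⃗}` ("`x_0 ⊗ ⋯ ⊗ x_j ↦` permuted", landing in the summand
with permuted index tuple) which "fixes the lattice", maps `O` to `O`, and [MODELLING, see module
docstring] preserves admissibility and `log μ̄`; for every summand the (Ind2) group ("`ℤ_p`-lattice
isomorphisms", "isometries") acting on it, preserving the lattice, admissibility and "the measure of
sets"; and the hull on each summand ("the smallest polydisc containing `Ω`") as a closure operator.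
[cite: DupuyHilado2025, §4.7, §4.9, §4.12] -/
structure IndPacketModel extends PacketModel F where
  /-- the log-shell lattice `I_{v⃗} = (2p)^{−(j+1)} ⊗_i log(O^×_{v̲_i}) ⊂ X_{v⃗}` (§4 intro, §4.7) -/
  shell : (p : ℕ) → (j : ℕ) → (e : Fin (j + 1) → placesOver F p) → Set (X p j e)
  /-- `I_{v⃗}` is admissible -/
  shell_adm : ∀ p j e, adm (shell p j e)
  /-- (Ind1) transport along `σ`: the summand indexed by `v⃗ ∘ σ` is carried onto the summand `v⃗` (§4.7) -/
  perm : {p j : ℕ} → (σ : Equiv.Perm (Fin (j + 1))) → (e : Fin (j + 1) → placesOver F p) →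
    X p j (e ∘ σ) ≃ X p j e
  /-- the transport along the identity permutation is the identity -/
  perm_one : ∀ {p j : ℕ} (e : Fin (j + 1) → placesOver F p) (x : X p j e), perm 1 e x = x
  /-- [MODELLING] the transport preserves admissibility … -/
  perm_adm : ∀ {p j : ℕ} (σ : Equiv.Perm (Fin (j + 1))) (e : Fin (j + 1) → placesOver F p)
    {U : Set (X p j (e ∘ σ))}, adm U → adm (perm σ e '' U)
  /-- [MODELLING] … and the normalised log-measure (ring isomorphism + `μ(O) = 1`, §2.4.5) -/
  logμ_perm : ∀ {p j : ℕ} (σ : Equiv.Perm (Fin (j + 1))) (e : Fin (j + 1) → placesOver F p)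
    {U : Set (X p j (e ∘ σ))}, adm U → logμ (perm σ e '' U) = logμ U
  /-- (Ind1) "fixes the lattice `⊕ I_{v⃗}`" (§4.7) -/
  perm_shell : ∀ {p j : ℕ} (σ : Equiv.Perm (Fin (j + 1))) (e : Fin (j + 1) → placesOver F p),
    perm σ e '' shell p j (e ∘ σ) = shell p j e
  /-- the (Ind2) group at the summand `v⃗` ("`Aut_{ℚ_p}(K_{v⃗} : I_{v⃗})`", §4.9) -/
  G₂ : (p : ℕ) → (j : ℕ) → (Fin (j + 1) → placesOver F p) → Type
  /-- it is a group -/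
  [group₂ : ∀ p j e, Group (G₂ p j e)]
  /-- acting on the summand -/
  [action₂ : ∀ p j e, MulAction (G₂ p j e) (X p j e)]
  /-- (Ind2) preserves admissibility -/
  smul_adm : ∀ {p j : ℕ} {e : Fin (j + 1) → placesOver F p} (g : G₂ p j e) {U : Set (X p j e)},
    adm U → adm (g • U)
  /-- (Ind2): "the measure of sets are preserved under these maps" (§4.9, footnote) -/
  logμ_smul : ∀ {p j : ℕ} {e : Fin (j + 1) → placesOver F p} (g : G₂ p j e) {U : Set (X p j e)},
    adm U → logμ (g • U) = logμ U
  /-- (Ind2) "also preserve this lattice" (§4 intro) -/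
  smul_shell : ∀ {p j : ℕ} {e : Fin (j + 1) → placesOver F p} (g : G₂ p j e),
    g • shell p j e = shell p j e
  /-- the hull on the summand `X_{v⃗}`: "the smallest polydisc containing `Ω`" (§4.12), a closure operator -/
  hullLoc : (p : ℕ) → (j : ℕ) → (e : Fin (j + 1) → placesOver F p) → ClosureOperator (Set (X p j e))

namespace IndPacketModel

attribute [instance] IndPacketModel.group₂ IndPacketModel.action₂

variable {F} (M : IndPacketModel F)

/-! ## (Ind1) on regions -/

/-- A global (Ind1)-element: one permutation `σ_j ∈ S_{j+1}` for every tensor degree `j` (§4.7: "for all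
`p`, the action of Ind1 … is simultaneous, that is `σ ∈ S_{j+1}` acts … on each factor"); the same for
every model `M` (the parameter only fixes dot-notation). [cite: DupuyHilado2025, §4.7] -/
abbrev Ind1Elt (_M : IndPacketModel F) : Type := (j : ℕ) → Equiv.Perm (Fin (j + 1))

/-- The (Ind1)-image `σ·B` of a region: in the summand `v⃗` it is the transport of the component of `B`
in the summand `v⃗ ∘ σ_j` (§4.7). [cite: DupuyHilado2025, §4.7] -/
def ind1 (σ : M.Ind1Elt) (B : M.Region) : M.Region := fun p j e => M.perm (σ j) e '' B p j (e ∘ σ j)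

/-- (Ind1) preserves admissibility of regions. [cite: DupuyHilado2025, §4.7] -/
theorem ind1_adm (σ : M.Ind1Elt) {B : M.Region} (hB : M.RegionAdm B) : M.RegionAdm (M.ind1 σ B) :=
  fun p j e => M.perm_adm (σ j) e (hB p j (e ∘ σ j))

/-- (Ind1) fixes the log-shell region `I = (I_{v⃗})` ("fixes the lattice", §4.7).
[cite: DupuyHilado2025, §4.7] -/
theorem ind1_shell (σ : M.Ind1Elt) : M.ind1 σ M.shell = M.shell := by
  funext p j e
  exact M.perm_shell (σ j) e

/-- The product weight `Π_k Pr(v_k)` of a tuple is invariant under permuting the tuple.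
[cite: DupuyHilado2025, §3.6, §4.7] -/
theorem prod_weight_comp_perm {p j : ℕ} (σ : Equiv.Perm (Fin (j + 1)))
    (e : Fin (j + 1) → placesOver F p) :
    ∏ k, weight F ((e ∘ σ) k).1 = ∏ k, weight F (e k).1 := by
  simp only [Function.comp_apply]
  exact Equiv.prod_comp σ (fun k => weight F (e k).1)

/-- **(Ind1) preserves `ln ν̄_{𝔸^{⊗ j+1}_{V̲,p}}`** on admissible regions: the transport preserves each
`log μ̄_{v⃗}` and the expectation over tuples is invariant under `v⃗ ↦ v⃗ ∘ σ`.
[cite: DupuyHilado2025, §4.7] -/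
theorem lnνTensorPower_ind1 (σ : M.Ind1Elt) {B : M.Region} (hB : M.RegionAdm B) (p j : ℕ) :
    M.lnνTensorPower p j (M.ind1 σ B) = M.lnνTensorPower p j B := by
  unfold PacketModel.lnνTensorPower ind1
  have h1 : ∀ e : Fin (j + 1) → placesOver F p,
      M.logμ (M.perm (σ j) e '' B p j (e ∘ σ j)) * ∏ k, weight F (e k).1 =
        M.logμ (B p j (e ∘ σ j)) * ∏ k, weight F ((e ∘ σ j) k).1 := by
    intro e
    rw [M.logμ_perm (σ j) e (hB p j _), prod_weight_comp_perm]
  simp_rw [h1]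
  -- reindex the sum along the bijection `e ↦ e ∘ σ_j`
  exact Function.Bijective.sum_comp (Equiv.arrowCongr (σ j) (Equiv.refl _)).symm.bijective
    (fun e => M.logμ (B p j e) * ∏ k, weight F (e k).1)

/-- **(Ind1) preserves `ln ν̄_𝕃`** on admissible regions. [cite: DupuyHilado2025, §4.7] -/
theorem lnνL_ind1 (σ : M.Ind1Elt) {B : M.Region} (hB : M.RegionAdm B) (lstar : ℕ) (T : Finset ℕ) :
    M.lnνL lstar T (M.ind1 σ B) = M.lnνL lstar T B := by
  unfold PacketModel.lnνL PacketModel.lnνLp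
  simp_rw [M.lnνTensorPower_ind1 σ hB]

/-! ## (Ind2) on regions -/

/-- A global (Ind2)-element: one lattice automorphism for every summand ("products of the automorphisms
on each of the summands", §4.9). [cite: DupuyHilado2025, §4.9] -/
abbrev Ind2Elt : Type _ := (p : ℕ) → (j : ℕ) → (e : Fin (j + 1) → placesOver F p) → M.G₂ p j e

/-- The (Ind2)-image `g·B` of a region (summandwise). [cite: DupuyHilado2025, §4.9] -/
def ind2 (g : M.Ind2Elt) (B : M.Region) : M.Region := fun p j e => g p j e • B p j e

/-- (Ind2) preserves admissibility of regions. [cite: DupuyHilado2025, §4.9] -/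
theorem ind2_adm (g : M.Ind2Elt) {B : M.Region} (hB : M.RegionAdm B) : M.RegionAdm (M.ind2 g B) :=
  fun p j e => M.smul_adm (g p j e) (hB p j e)

/-- (Ind2) fixes the log-shell region ("also preserve this lattice", §4 intro).
[cite: DupuyHilado2025, §4.9] -/
theorem ind2_shell (g : M.Ind2Elt) : M.ind2 g M.shell = M.shell := by
  funext p j e
  exact M.smul_shell (g p j e)

/-- **(Ind2) preserves `ln ν̄_𝕃`** on admissible regions ("the measure of sets are preserved").
[cite: DupuyHilado2025, §4.9] -/
theorem lnνL_ind2 (g : M.Ind2Elt) {B : M.Region} (hB : M.RegionAdm B) (lstar : ℕ) (T : Finset ℕ) :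
    M.lnνL lstar T (M.ind2 g B) = M.lnνL lstar T B := by
  unfold PacketModel.lnνL PacketModel.lnνLp PacketModel.lnνTensorPower ind2
  simp_rw [M.logμ_smul _ (hB _ _ _)]

/-! ## (Ind3) as a datum, `U_Θ`, hulls -/

/-- **(Ind3)-datum** for a theta-idele `t` (Dupuy–Hilado §4.10 with §1 p. 4): the region
`(O_𝕃(−P_Θ))^{Ind3}`, admissible, CONTAINING `O_𝕃(−P_Θ)` (upper-bound formulation: [IUTchIII] Thm. 3.11
(ii) (Ind3) "upper semi-compatible … natural inclusions "⊆""), and BOUNDED as in (4.10): in the summand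
`(v_0,…,v_j)` of degree `j = i+1` it lies in `⋃_{n ≥ 0} t_{j,v_j}^n · I_{v⃗}` ("`(q̲^{j²})^ℕ · Peel^j I`").
HYPOTHESIS/INTERFACE structure — Ind3 itself is "the subject of our second paper".
[cite: DupuyHilado2025, §4.10] -/
structure Ind3Datum {lstar : ℕ} (t : M.LgpIdele lstar) where
  /-- `(O_𝕃(−P_Θ))^{Ind3}` -/
  bare3 : M.Region
  /-- admissible -/
  bare3_adm : M.RegionAdm bare3
  /-- contains the bare region `O_𝕃(−P_Θ) = O_𝕃(−div t)` -/
  region_subset : ∀ p j e, M.region t p j e ⊆ bare3 p j e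
  /-- the bound (4.10) in the degrees `j = i+1` occurring in `𝕃` -/
  subset_bound : ∀ (p : ℕ) (i : Fin lstar) (e : Fin ((i : ℕ) + 1 + 1) → placesOver F p),
    bare3 p ((i : ℕ) + 1) e ⊆
      ⋃ n : ℕ, (M.peel (t i p (e (Fin.last _))))^[n] '' M.shell p ((i : ℕ) + 1) e

/-- The POSSIBLE IMAGES making up `U_Θ = Ind2(Ind1((O_𝕃(−P_Θ))^{Ind3}))` (§4.11), indexed by a global
(Ind2)-element and a global (Ind1)-element, in Dupuy–Hilado's order of operations.
[cite: DupuyHilado2025, §4.11] -/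
def UTheta {lstar : ℕ} {t : M.LgpIdele lstar} (D : M.Ind3Datum t) (lam : M.Ind2Elt × M.Ind1Elt) :
    M.Region :=
  M.ind2 lam.1 (M.ind1 lam.2 D.bare3)

/-- `U_Θ` itself: the union of the possible images (componentwise). [cite: DupuyHilado2025, §4.11] -/
def UThetaUnion {lstar : ℕ} {t : M.LgpIdele lstar} (D : M.Ind3Datum t) : M.Region :=
  fun p j e => ⋃ lam, M.UTheta D lam p j e

/-- Every possible image is admissible. [cite: DupuyHilado2025, §4.11] -/
theorem UTheta_adm {lstar : ℕ} {t : M.LgpIdele lstar} (D : M.Ind3Datum t) (lam : M.Ind2Elt × M.Ind1Elt) :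
    M.RegionAdm (M.UTheta D lam) :=
  M.ind2_adm _ (M.ind1_adm _ D.bare3_adm)

/-- **Every possible image has the log-volume of `(O_𝕃(−P_Θ))^{Ind3}`**: `ln ν̄_𝕃(g·σ·(O_𝕃(−P_Θ))^{Ind3})
= ln ν̄_𝕃((O_𝕃(−P_Θ))^{Ind3})` — (Ind1) and (Ind2) act on `−|log(Θ)|` only through the hull of the union.
This REDUCES the log-volume invariance of (Ind1)/(Ind2) (which the summit-side files keep as a named
hypothesis) to the summand-level interface fields `logμ_perm` (modelling) and `logμ_smul` (§4.9
footnote); it does not prove those. [cite: DupuyHilado2025, §4.7, §4.9, §4.11] -/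
theorem lnνL_UTheta {lstar : ℕ} {t : M.LgpIdele lstar} (D : M.Ind3Datum t) (lam : M.Ind2Elt × M.Ind1Elt)
    (T : Finset ℕ) :
    M.lnνL lstar T (M.UTheta D lam) = M.lnνL lstar T D.bare3 := by
  unfold UTheta
  rw [M.lnνL_ind2 _ (M.ind1_adm _ D.bare3_adm), M.lnνL_ind1 _ D.bare3_adm]

/-- The bare region lies in the possible image of the identity indeterminacies.
[cite: DupuyHilado2025, §4.11] -/
theorem region_subset_UTheta_one {lstar : ℕ} {t : M.LgpIdele lstar} (D : M.Ind3Datum t) (p j : ℕ)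
    (e : Fin (j + 1) → placesOver F p) :
    M.region t p j e ⊆ M.UTheta D ((fun _ _ _ => 1), (fun _ => 1)) p j e := by
  intro x hx
  simp only [UTheta, ind2, ind1, one_smul]
  exact ⟨x, D.region_subset p j e hx, M.perm_one e x⟩

/-- The bare region has log-volume at most that of `(O_𝕃(−P_Θ))^{Ind3}`. [cite: DupuyHilado2025, §4.10] -/
theorem lnνL_region_le_bare3 {lstar : ℕ} {t : M.LgpIdele lstar} (D : M.Ind3Datum t) (T : Finset ℕ) :
    M.lnνL lstar T (M.region t) ≤ M.lnνL lstar T D.bare3 :=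
  M.lnνL_mono lstar T (M.region_adm t) D.bare3_adm D.region_subset

/-- **The hull** of a region, summand by summand ("it suffices to define hulls locally … `hull(Ω) :=
Π_p hull(Ω_p)`", §4.12), as a closure operator on regions. [cite: DupuyHilado2025, §4.12] -/
def hull : ClosureOperator M.Region :=
  ClosureOperator.mk' (fun B p j e => M.hullLoc p j e (B p j e))
    (fun B₁ B₂ h p j e => (M.hullLoc p j e).monotone (h p j e))
    (fun B p j e => (M.hullLoc p j e).le_closure (B p j e))
    (fun B p j e => by
      show M.hullLoc p j e (M.hullLoc p j e (B p j e)) ≤ M.hullLoc p j e (B p j e)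
      rw [(M.hullLoc p j e).idempotent])

/-- The hull, componentwise. [cite: DupuyHilado2025, §4.12] -/
theorem hull_apply (B : M.Region) (p j : ℕ) (e : Fin (j + 1) → placesOver F p) :
    M.hull B p j e = M.hullLoc p j e (B p j e) := rfl

/-- A region lies in its hull. [cite: DupuyHilado2025, §4.12] -/
theorem le_hull (B : M.Region) : B ≤ M.hull B := M.hull.le_closure B

/-- `ln ν̄_𝕃(B) ≤ ln ν̄_𝕃(hull(B))` when both are admissible (monotonicity).
[cite: DupuyHilado2025, §4.12] -/
theorem lnνL_le_hull (lstar : ℕ) (T : Finset ℕ) {B : M.Region} (hB : M.RegionAdm B)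
    (hH : M.RegionAdm (M.hull B)) : M.lnνL lstar T B ≤ M.lnνL lstar T (M.hull B) :=
  M.lnνL_mono lstar T hB hH (fun p j e => M.le_hull B p j e)

/-- `hull(U_Θ)`: the holomorphic hull of the union of the possible images — the region whose log-volume
is `−|log(Θ)|` in (1.1). [cite: DupuyHilado2025, §1 (1.1), §4.11–4.12] -/
def hullUTheta {lstar : ℕ} {t : M.LgpIdele lstar} (D : M.Ind3Datum t) : M.Region :=
  M.hull (M.UThetaUnion D)

/-- Each possible image lies in `hull(U_Θ)`. [cite: DupuyHilado2025, §4.11–4.12] -/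
theorem UTheta_le_hullUTheta {lstar : ℕ} {t : M.LgpIdele lstar} (D : M.Ind3Datum t)
    (lam : M.Ind2Elt × M.Ind1Elt) : M.UTheta D lam ≤ M.hullUTheta D := by
  intro p j e x hx
  apply M.le_hull
  exact Set.mem_iUnion.mpr ⟨lam, hx⟩

end IndPacketModel

end Literature.IUT.LogVolume

end
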